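import Mathlib.RingTheory.DiscreteValuationRing.Basic
import Literature.RingTheory.RegularLocalRing.QuotientDVR
import Summits.ResolutionOfSingularities.ResolutionOfSingularities.Theorems.WeightedInvariantWeightedConstructionInitialIdeal
import Summits.ResolutionOfSingularities.ResolutionOfSingularities.Theorems.WeightedInvariantWeightedConstructionFormalChartAlgebra
import HarnessLib

/-!
# The e.f.t. local weighted game (door `HypersurfaceCentreConstruction`, key H2a′) in dimension one

Topic: `Summits/ResolutionOfSingularities/ResolutionOfSingularities/Theorems`. Helper for the door item
`HypersurfaceCentreConstruction` (statement `stmt-ResolutionOfSingularities-19897`, route `WeightedInvariant`),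
line `local-engine` v2 of `res-L1-w43-plan-1` (L W4.3, ORDERS (o9) 2026-08-27T04:51:57Z): the TYPING-SANITY
RUNG `dim S = 1` of the candidate clause H2a′ `LocalWeightedDropEFT p` (file
`L/res-L1-w43-plan-1/door_local_engine_v2_candidate.lean`, sha16 `39f1da1b4d6446b3`).

[OURS · L1 W4.3] Replaces the role of NO printed item; NOT a statement of the manuscript
[claim: Hironaka2017, status: under-review]. AI work, weaker than expert review.

## Statement proved

For EVERY class function `ι` (no invariance needed) and every regular local ring `S` of Krull
dimension `1` (no base field needed), every `0 ≠ f ∈ 𝔪_S²` admits the move `n = 1`, `u = (ϖ)`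
(a uniformiser), `w = (1)` satisfying the `∀`-clause of `LocalWeightedDropEFT p` VERBATIM
(`localGameEFT_clause_of_ringKrullDim_eq_one`; the corollary
`localWeightedDropEFT_clause_of_ringKrullDim_eq_one` carries the idle binders `k₀`, `Algebra k₀ S`,
`Algebra.EssFiniteType k₀ S` of the def so that an assembly by cases on `dim S` can `exact` it):

* `(u) = 𝔪_S`, `spanFinrank 𝔪_S = 1`, `0 < w 0`;
* ADMISSIBILITY: a prime `P ∋ ϖ` is `𝔪_S`, so `f ∈ P²` maps into `𝔪_{S_P}²`;
* SUCCESSOR CLAUSE — VACUOUS: in `B = S[t⁻¹, 𝒥ₙ tⁿ] = S[t⁻¹, ϖ t]` write `f = υ ϖᵐ` (`S` is a DVR);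
  if `f = (t⁻¹)ᵃ g` with `t⁻¹ ∤ g` then `g = C(f) tᵃ` as a Laurent polynomial, its `tᵃ`-coefficient
  `f` lies in `𝒥ₐ = (ϖᵃ)` (`InitialIdeal.coeff_mem_weightedMonomialIdeal`), so `a ≤ m`; `a < m` would
  give `g = t⁻¹ · (C(f) t^{a+1})` with `C(f) t^{a+1} ∈ B`; hence `a = m` and `g = υ (ϖ t)ᵐ`. The vertex
  ideal is contained in `(ϖ t)` (`vertexIdeal_le_span_u'`), so a prime `𝔫 ⊉ Vert` omits `ϖ t`, `g` is
  a unit of `B_𝔫`, and the hypothesis `g ∈ 𝔪_{B_𝔫}²` is absurd — the successor germ is never singular.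

REPORT FOR THE TYPING (o9's purpose): no clause of H2a′ is awkward in dimension one; the two
hypotheses `t⁻¹ ∈ 𝔫` and `𝔪_S B ≤ 𝔫` of the successor clause are not needed here (the win is off the
vertex for every prime), and `f ≠ 0` is used only to factor `f`.

## References

* J. Włodarczyk, *Functorial resolution by torus actions*, arXiv:2203.03090, Def. 2.3.5 (full
  cobordant blow-up `B = Spec 𝒪[t⁻¹, uᵢ t^{wᵢ}]`, vertex), §3.3 (strict transform). [Wlodarczyk2022]
* H. Matsumura, *Commutative Ring Theory*, Thm. 11.2 (regular local of dimension one = DVR).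
  [Matsumura1987]
-/

noncomputable section

open IsLocalRing Literature.AlgebraicGeometry.Resolution
open LaurentPolynomial
open scoped LaurentPolynomial

set_option linter.dupNamespace false -- mandated namespace of this single-conjunct summit

namespace Summit.ResolutionOfSingularities.ResolutionOfSingularities.Theorems

namespace LocalGameEFTDimOne

variable {S : Type} [CommRing S]

/-- For the one-element chart `u = (ϖ)`, `w = (1)`, the weighted monomial ideal of degree `n` is
contained in `(ϖⁿ)` (it is `(ϖ^α : α ≥ n)`). [folklore] -/
theorem weightedMonomialIdeal_one_le (ϖ : S) (n : ℕ) :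
    weightedMonomialIdeal (fun _ : Fin 1 => ϖ) (fun _ => 1) n ≤ Ideal.span {ϖ ^ n} := by
  rw [weightedMonomialIdeal, Ideal.span_le]
  rintro x ⟨α, hα, rfl⟩
  rw [Fin.sum_univ_one, one_mul] at hα
  rw [SetLike.mem_coe, Fin.prod_univ_one, Ideal.mem_span_singleton]
  exact pow_dvd_pow ϖ hα

/-- For the one-element chart `u = (ϖ)`, `w = (1)`: `c ϖᵐ ∈ 𝒥ₙ` whenever `n ≤ m`. [folklore] -/
theorem mul_pow_mem_weightedMonomialIdeal_one (ϖ c : S) {n m : ℕ} (h : n ≤ m) :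
    c * ϖ ^ m ∈ weightedMonomialIdeal (fun _ : Fin 1 => ϖ) (fun _ => 1) n := by
  refine Ideal.mul_mem_left _ c (Ideal.subset_span ⟨fun _ => m, ?_, ?_⟩)
  · rw [Fin.sum_univ_one, one_mul]; exact h
  · rw [Fin.prod_univ_one]

/-- In `S[t⁻¹, 𝒥ₙ tⁿ]`, if `(t⁻¹)ᵃ g = C(f)` then `g = C(f) tᵃ` as a Laurent polynomial. [folklore] -/
theorem coe_eq_C_mul_T_of_eq {I : ℕ → Ideal S} {f : S} {a : ℕ} {g : extReesAlgebra I}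
    (h : algebraMap S (extReesAlgebra I) f = extReesAlgebra.tInv I ^ a * g) :
    (g : S[T;T⁻¹]) = C f * T (a : ℤ) := by
  have h' := congrArg Subtype.val h
  simp only [Subalgebra.coe_algebraMap, MulMemClass.coe_mul, SubmonoidClass.coe_pow,
    extReesAlgebra.coe_tInv, T_pow] at h'
  rw [← C_eq_algebraMap] at h'
  calc (g : S[T;T⁻¹]) = T (a : ℤ) * (T ((a : ℤ) * -1) * (g : S[T;T⁻¹])) := by
        rw [← mul_assoc, ← T_add, show (a : ℤ) + (a : ℤ) * -1 = 0 by ring, T_zero, one_mul]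
    _ = C f * T (a : ℤ) := by rw [← h', mul_comm]

end LocalGameEFTDimOne

open LocalGameEFTDimOne in
/-- **The e.f.t. local weighted game in dimension one, for every rank function.** Let `S` be a
regular local ring of Krull dimension `1` and `0 ≠ f ∈ 𝔪_S²`. Then the move `n = 1`, `u = (ϖ)`
(`ϖ` a uniformiser), `w = (1)` satisfies the `∀`-clause of the candidate H2a′ `LocalWeightedDropEFT`
(door `HypersurfaceCentreConstruction`, line `local-engine` v2) for EVERY `ι`: `(ϖ) = 𝔪_S`,
`spanFinrank 𝔪_S = 1`, the weight is positive, the centre `V(ϖ)` is admissible (`f ∈ 𝔪_{S_P}²` for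
every prime `P ∋ ϖ`, as `P = 𝔪_S`), and the successor clause holds VACUOUSLY: for every prime `𝔫`
of the full cobordant blow-up algebra `B = S[t⁻¹, ϖ t]` not containing the vertex ideal and every
factorisation `f = (t⁻¹)ᵃ g` with `t⁻¹ ∤ g`, the element `g = υ (ϖ t)ᵐ` (`f = υ ϖᵐ`) is a unit of
`B_𝔫`, so `g ∉ 𝔪_{B_𝔫}²`. [OURS · L1 W4.3 · typing-sanity rung (o9)] -/
theorem localGameEFT_clause_of_ringKrullDim_eq_one
    (ι : (R : Type) → [CommRing R] → R → Ordinal.{0})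
    (S : Type) [CommRing S] [IsRegularLocalRing S] (hdim : ringKrullDim S = 1)
    (f : S) (hf0 : f ≠ 0) (hf2 : f ∈ (maximalIdeal S) ^ 2) :
    ∃ (n : ℕ) (u : Fin n → S) (w : Fin n → ℕ),
      Ideal.span (Set.range u) = maximalIdeal S ∧ (maximalIdeal S).spanFinrank = n ∧ (∃ i, 0 < w i) ∧
      (∀ (P : Ideal S) [P.IsPrime], (∀ i, 0 < w i → u i ∈ P) →
        algebraMap S (Localization.AtPrime P) f ∈ (maximalIdeal (Localization.AtPrime P)) ^ 2) ∧
      ∀ (𝔫 : Ideal (extReesAlgebra (weightedMonomialIdeal u w))) [𝔫.IsPrime],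
        extReesAlgebra.tInv (weightedMonomialIdeal u w) ∈ 𝔫 →
        (maximalIdeal S).map (algebraMap S (extReesAlgebra (weightedMonomialIdeal u w))) ≤ 𝔫 →
        ¬ (extReesAlgebra.vertexIdeal (weightedMonomialIdeal u w) ≤ 𝔫) →
        ∀ (a : ℕ) (g : extReesAlgebra (weightedMonomialIdeal u w)),
          algebraMap S (extReesAlgebra (weightedMonomialIdeal u w)) f =
            extReesAlgebra.tInv (weightedMonomialIdeal u w) ^ a * g →
          ¬ (extReesAlgebra.tInv (weightedMonomialIdeal u w) ∣ g) →
          algebraMap (extReesAlgebra (weightedMonomialIdeal u w)) (Localization.AtPrime 𝔫) g ∈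
            (maximalIdeal (Localization.AtPrime 𝔫)) ^ 2 →
          ι (Localization.AtPrime 𝔫)
              (algebraMap (extReesAlgebra (weightedMonomialIdeal u w)) (Localization.AtPrime 𝔫) g) <
            ι S f := by
  classical
  -- `S` is a discrete valuation ring: pick a uniformiser and factor `f = υ ϖᵐ`
  haveI := isDomain_of_isRegularLocalRing S
  haveI : IsDiscreteValuationRing S :=
    Literature.RingTheory.RegularLocalRing.isDiscreteValuationRing_of_ringKrullDim_eq_one hdim
  obtain ⟨ϖ, hirr⟩ := IsDiscreteValuationRing.exists_irreducible S
  have h𝔪 : maximalIdeal S = Ideal.span {ϖ} :=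
    (IsDiscreteValuationRing.irreducible_iff_uniformizer ϖ).mp hirr
  obtain ⟨m, υ, hfυ⟩ := IsDiscreteValuationRing.eq_unit_mul_pow_irreducible hf0 hirr
  -- the move
  set u : Fin 1 → S := fun _ => ϖ with hu
  set w : Fin 1 → ℕ := fun _ => 1 with hw
  refine ⟨1, u, w, ?_, ?_, ⟨0, Nat.one_pos⟩, ?_, ?_⟩
  · -- `(ϖ) = 𝔪`
    rw [hu, Set.range_const, h𝔪]
  · -- embedding dimension one
    have h := IsRegularLocalRing.spanFinrank_maximalIdeal (R := S)
    rw [hdim] at h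
    exact_mod_cast h
  · -- admissibility: a prime containing `ϖ` is `𝔪`
    intro P _ hP
    have hle : maximalIdeal S ≤ P := by
      rw [h𝔪, Ideal.span_singleton_le_iff_mem]
      exact hP 0 Nat.one_pos
    have hfP : f ∈ P ^ 2 := Ideal.pow_right_mono hle 2 hf2
    have := Ideal.mem_map_of_mem (algebraMap S (Localization.AtPrime P)) hfP
    rwa [Ideal.map_pow, Localization.AtPrime.map_eq_maximalIdeal] at this
  · -- successor clause: vacuous
    intro 𝔫 _ _ _ hV a g hfg hndvd hg2
    exfalso
    -- the generator `ϖ t` of `B = S[t⁻¹, ϖ t]`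
    have hϖI : ϖ ∈ weightedMonomialIdeal u w 1 := by
      simpa [hu, hw] using mul_pow_mem_weightedMonomialIdeal_one ϖ 1 (le_refl 1)
    let ϖT : extReesAlgebra (weightedMonomialIdeal u w) :=
      ⟨C ϖ * T ((1 : ℕ) : ℤ), extReesAlgebra.C_mul_T_mem _ Nat.one_pos hϖI⟩
    -- `g = C(f) tᵃ`
    have hgval : (g : S[T;T⁻¹]) = C f * T (a : ℤ) := coe_eq_C_mul_T_of_eq hfg
    -- the `tᵃ`-coefficient `f` of `g` lies in `𝒥ₐ ⊆ (ϖᵃ)`, so `a ≤ m`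
    have hcoeff : (g : S[T;T⁻¹]).coeff (a : ℤ) = f := by
      rw [hgval, ← single_eq_C_mul_T, AddMonoidAlgebra.coeff_single, Finsupp.single_eq_same]
    have hfa : f ∈ Ideal.span {ϖ ^ a} := by
      have h := InitialIdeal.coeff_mem_weightedMonomialIdeal u w g a
      rw [hcoeff] at h
      exact weightedMonomialIdeal_one_le ϖ a (by simpa [hu, hw] using h)
    have ham : a ≤ m := by
      rw [Ideal.mem_span_singleton, hfυ, Units.dvd_mul_left] at hfa
      exact (pow_dvd_pow_iff hirr.ne_zero hirr.not_isUnit).mp hfa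
    -- `a < m` would make `g` divisible by `t⁻¹`
    have hma : ¬ a < m := by
      intro hlt
      apply hndvd
      have hfI : f ∈ weightedMonomialIdeal u w (a + 1) := by
        rw [hfυ]
        simpa [hu, hw] using mul_pow_mem_weightedMonomialIdeal_one ϖ (υ : S) hlt
      refine ⟨⟨C f * T ((a + 1 : ℕ) : ℤ), extReesAlgebra.C_mul_T_mem _ (Nat.succ_pos a) hfI⟩,
        Subtype.ext ?_⟩
      rw [MulMemClass.coe_mul, extReesAlgebra.coe_tInv, hgval, mul_left_comm, ← T_add]
      congr 2
      push_cast
      ring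
    have hameq : a = m := le_antisymm ham (not_lt.mp hma)
    -- hence `g = υ (ϖ t)ᵐ`
    have hgeq : g = algebraMap S (extReesAlgebra (weightedMonomialIdeal u w)) (υ : S) * ϖT ^ m := by
      apply Subtype.ext
      rw [hgval, hameq, hfυ, MulMemClass.coe_mul, SubmonoidClass.coe_pow, Subalgebra.coe_algebraMap,
        ← C_eq_algebraMap, map_mul, map_pow, mul_pow, ← map_pow, T_pow, mul_assoc]
      congr 3
      push_cast
      ring
    -- the vertex ideal lies in `(ϖ t)`, so `ϖ t ∉ 𝔫`
    have hE : extReesAlgebra (weightedMonomialIdeal u w) = cobordantAlgebra u w :=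
      stub_extReesAlgebra_weighted u w
    have hVle : extReesAlgebra.vertexIdeal (weightedMonomialIdeal u w) ≤ Ideal.span {ϖT} := by
      have h := vertexIdeal_le_span_u' u w hE (fun _ : Fin 1 => ϖT) (fun _ => rfl) (fun _ => rfl)
      rwa [Set.range_const] at h
    have hϖT𝔫 : ϖT ∉ 𝔫 := fun hmem =>
      hV (hVle.trans ((Ideal.span_singleton_le_iff_mem _).mpr hmem))
    -- so `g` is a unit at `𝔫`, contradicting `g ∈ 𝔪_{B_𝔫}²`
    have hunit : IsUnit (algebraMap (extReesAlgebra (weightedMonomialIdeal u w))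
        (Localization.AtPrime 𝔫) g) := by
      rw [hgeq, map_mul, map_pow]
      refine IsUnit.mul ((υ.isUnit.map _).map _) (IsUnit.pow m ?_)
      exact IsLocalization.map_units (Localization.AtPrime 𝔫) (⟨ϖT, hϖT𝔫⟩ : 𝔫.primeCompl)
    have hmem : algebraMap (extReesAlgebra (weightedMonomialIdeal u w)) (Localization.AtPrime 𝔫) g ∈
        maximalIdeal (Localization.AtPrime 𝔫) := Ideal.pow_le_self two_ne_zero hg2
    exact (mem_nonunits_iff.mp ((IsLocalRing.mem_maximalIdeal _).mp hmem)) hunit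

/-- **The clause of `LocalWeightedDropEFT p` restricted to `ringKrullDim S = 1`, for every `ι`** —
with the def's binders (`k₀` perfect of characteristic `p`, `S` a regular local `k₀`-algebra
essentially of finite type), which play no role in dimension one: the statement an assembly of
`LocalWeightedDropEFT p` by cases on `dim S` consumes with `exact`. Proof:
`localGameEFT_clause_of_ringKrullDim_eq_one`. [OURS · L1 W4.3 · typing-sanity rung (o9)] -/
theorem localWeightedDropEFT_clause_of_ringKrullDim_eq_one (p : ℕ)
    (ι : (R : Type) → [CommRing R] → R → Ordinal.{0})
    (k₀ : Type) [Field k₀] [CharP k₀ p] [PerfectField k₀]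
    (S : Type) [CommRing S] [Algebra k₀ S] [Algebra.EssFiniteType k₀ S] [IsRegularLocalRing S]
    (hdim : ringKrullDim S = 1)
    (f : S) (hf0 : f ≠ 0) (hf2 : f ∈ (maximalIdeal S) ^ 2) :
    ∃ (n : ℕ) (u : Fin n → S) (w : Fin n → ℕ),
      Ideal.span (Set.range u) = maximalIdeal S ∧ (maximalIdeal S).spanFinrank = n ∧ (∃ i, 0 < w i) ∧
      (∀ (P : Ideal S) [P.IsPrime], (∀ i, 0 < w i → u i ∈ P) →
        algebraMap S (Localization.AtPrime P) f ∈ (maximalIdeal (Localization.AtPrime P)) ^ 2) ∧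
      ∀ (𝔫 : Ideal (extReesAlgebra (weightedMonomialIdeal u w))) [𝔫.IsPrime],
        extReesAlgebra.tInv (weightedMonomialIdeal u w) ∈ 𝔫 →
        (maximalIdeal S).map (algebraMap S (extReesAlgebra (weightedMonomialIdeal u w))) ≤ 𝔫 →
        ¬ (extReesAlgebra.vertexIdeal (weightedMonomialIdeal u w) ≤ 𝔫) →
        ∀ (a : ℕ) (g : extReesAlgebra (weightedMonomialIdeal u w)),
          algebraMap S (extReesAlgebra (weightedMonomialIdeal u w)) f =
            extReesAlgebra.tInv (weightedMonomialIdeal u w) ^ a * g →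
          ¬ (extReesAlgebra.tInv (weightedMonomialIdeal u w) ∣ g) →
          algebraMap (extReesAlgebra (weightedMonomialIdeal u w)) (Localization.AtPrime 𝔫) g ∈
            (maximalIdeal (Localization.AtPrime 𝔫)) ^ 2 →
          ι (Localization.AtPrime 𝔫)
              (algebraMap (extReesAlgebra (weightedMonomialIdeal u w)) (Localization.AtPrime 𝔫) g) <
            ι S f :=
  localGameEFT_clause_of_ringKrullDim_eq_one ι S hdim f hf0 hf2

end Summit.ResolutionOfSingularities.ResolutionOfSingularities.Theorems

end
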